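import Mathlib
import Literature.Analysis.ODE.GlobalExistence
import Literature.Analysis.FluidPDE.SelfSimilarEulerProfile
import HarnessLib.Audit

/-!
# Rung C1 of the crux `EulerZoomLiouville.PowerGaugeEulerLiouville` (W3a step L0): a backward half-trajectory of a `C¹` field of
# linear growth EXTENDS to a global trajectory

Route №10 `EulerZoomLiouville` (NavierStokesRegularity), crux E = stmt-NavierStokesRegularity-19832, tenure rung C1,
registered residue `stub_selfSimilarExtremalRest`, sub-stratum W3a (bounded `C²` profiles with UNBOUNDED gradient).  Lineage
ns-typeII-p2 (gen 8, INTERIM LEAD).  The localisation programme (HOME/ns-typeII-p2/W3a-PLAN-19832.md) runs the flow of a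
cut-off field `Ṽ` (globally Lipschitz) but feeds the trajectory-level lemmas of the tree (`IsSelfSimilarEulerProfile.…_of_bounded`,
ns-typeII-p1's limit-set kill), which are stated for curves `Y` with `Y' = −W(Y)` at EVERY real time, with the TRUE field
`W = γy + V`; the confined backward `Ṽ`-orbit is a `W`-curve only for `t ≥ 0`.  This file supplies the missing half:

* `exists_lipschitzOnWith_closedBall_of_contDiff` — a `C¹` field is Lipschitz on every closed ball (mean value inequality);
* `exists_forward_solution_of_linearGrowth` — a `C¹` field `W` with `‖W y‖ ≤ a‖y‖ + b` has, through every point, a solution of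
  `β' = W(β)` on `[0, ∞)` (the tree's continuation principle `Literature.Analysis.ODE.exists_solution_Ici_of_apriori_bound` with
  the Grönwall a-priori bound);
* **`exists_hasDerivAt_extension_of_linearGrowth`** — if `Yp' = −W(Yp)` for `t ≥ 0`, there is a curve `Y` agreeing with `Yp` on
  `[0, ∞)` with `Y' = −W(Y)` at EVERY real time (time-reversed forward solution glued at `0`).

WHAT THIS IS NOT: not NS, not E, not rung C1 — an ODE gluing lemma. [folklore; Hartman, *ODE*, Ch. II Thm 3.1 (continuation);
Teschl, GSM 140, Cor. 2.16]
-/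

noncomputable section

-- flat `Theorems/<Route><Decl>…` files of one crux share the namespace of the crux (tree convention)
set_option linter.dupNamespace false

open MeasureTheory Set Filter Topology Metric Function
open scoped NNReal

namespace Summit.NavierStokesRegularity.NavierStokesRegularity.Theorems.PowerGaugeEulerLiouville.Loc

/-- A `C¹` field on `ℝ³` is Lipschitz on every closed ball (mean value inequality on the convex ball, derivative bounded there by
compactness). [folklore] -/
theorem exists_lipschitzOnWith_closedBall_of_contDiff {W : EuclideanSpace ℝ (Fin 3) → EuclideanSpace ℝ (Fin 3)}
    (hW : ContDiff ℝ 1 W) (ρ : ℝ) :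
    ∃ K : ℝ≥0, LipschitzOnWith K W (closedBall (0 : EuclideanSpace ℝ (Fin 3)) ρ) := by
  obtain ⟨C, hC⟩ := (isCompact_closedBall (0 : EuclideanSpace ℝ (Fin 3)) ρ).exists_bound_of_continuousOn
    (hW.continuous_fderiv one_ne_zero).continuousOn
  refine ⟨Real.toNNReal C, (convex_closedBall _ _).lipschitzOnWith_of_nnnorm_fderiv_le
    (fun x _ => hW.differentiable one_ne_zero x) (fun x hx => ?_)⟩
  rw [← norm_toNNReal]
  exact Real.toNNReal_le_toNNReal (hC x hx)

/-- **Forward global existence for a `C¹` field of linear growth**: if `W ∈ C¹(ℝ³; ℝ³)` and `‖W y‖ ≤ a‖y‖ + b`, then through every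
`x` there is `β : [0, ∞) → ℝ³` with `β 0 = x`, `β' = W(β)` (`HasDerivAt` for `t > 0`, right derivative at `0`).  The a-priori
bound is Grönwall's `‖β t‖ ≤ gronwallBound ‖x‖ a b t`. [cite: Hartman2002, Ch. II Thm. 3.1 (PDF p. 25)] -/
theorem exists_forward_solution_of_linearGrowth {W : EuclideanSpace ℝ (Fin 3) → EuclideanSpace ℝ (Fin 3)}
    (hW : ContDiff ℝ 1 W) {a b : ℝ} (ha : 0 ≤ a) (hb : 0 ≤ b) (hab : ∀ y, ‖W y‖ ≤ a * ‖y‖ + b)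
    (x : EuclideanSpace ℝ (Fin 3)) :
    ∃ β : ℝ → EuclideanSpace ℝ (Fin 3), β 0 = x ∧
      (∀ t, 0 ≤ t → HasDerivWithinAt β (W (β t)) (Ici 0) t) ∧ ∀ t, 0 < t → HasDerivAt β (W (β t)) t := by
  -- work with the rate `k = a + 1 > 0`
  set k : ℝ := a + 1 with hk
  have hk0 : 0 < k := by rw [hk]; linarith
  have hkne : k ≠ 0 := ne_of_gt hk0
  have hab' : ∀ y, ‖W y‖ ≤ k * ‖y‖ + b := fun y => (hab y).trans (by rw [hk]; nlinarith [norm_nonneg y])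
  have hgb : ∀ t, gronwallBound ‖x‖ k b t = ‖x‖ * Real.exp (k * t) + b / k * (Real.exp (k * t) - 1) := fun t => by
    rw [gronwallBound_of_K_ne_0 hkne]
  have hmono : ∀ t T : ℝ, 0 ≤ t → t ≤ T → gronwallBound ‖x‖ k b t ≤ gronwallBound ‖x‖ k b T := by
    intro t T ht htT
    rw [hgb, hgb]
    have h1 : Real.exp (k * t) ≤ Real.exp (k * T) := Real.exp_le_exp.2 (by nlinarith)
    have h3 : 0 ≤ b / k := div_nonneg hb hk0.le
    exact add_le_add (mul_le_mul_of_nonneg_left h1 (norm_nonneg _))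
      (mul_le_mul_of_nonneg_left (sub_le_sub_right h1 1) h3)
  have hx0 : ‖x‖ ≤ gronwallBound ‖x‖ k b 0 := by rw [gronwallBound_x0]
  obtain ⟨β, hβ0, -, hβ1, hβ2⟩ := Literature.Analysis.ODE.exists_solution_Ici_of_apriori_bound
    (v := fun _ : ℝ => W) (x₀ := x)
    (fun _ ρ => by
      obtain ⟨K, hK⟩ := exists_lipschitzOnWith_closedBall_of_contDiff hW ρ
      exact ⟨K, fun _ _ => hK⟩)
    (fun _ => continuousOn_const)
    (fun T hT => by
      refine ⟨gronwallBound ‖x‖ k b T, hx0.trans (hmono 0 T le_rfl hT), fun s hs α hα0 hα t ht => ?_⟩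
      have hcontα : ContinuousOn α (Icc 0 s) := fun τ hτ => (hα τ hτ).continuousWithinAt
      have hder : ∀ τ ∈ Ico 0 s, HasDerivWithinAt α (W (α τ)) (Ici τ) τ := fun τ hτ =>
        (hα τ (Ico_subset_Icc_self hτ)).mono_of_mem_nhdsWithin
          (mem_of_superset (Icc_mem_nhdsGE hτ.2) (Icc_subset_Icc hτ.1 le_rfl))
      have hbound : ∀ τ ∈ Ico 0 s, ‖W (α τ)‖ ≤ k * ‖α τ‖ + b := fun τ _ => hab' (α τ)
      have h := norm_le_gronwallBound_of_norm_deriv_right_le hcontα hder (le_of_eq (by rw [hα0])) hbound t ht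
      rw [sub_zero] at h
      exact h.trans (hmono t T ht.1 (ht.2.trans hs.2)))
  exact ⟨β, hβ0, hβ1, hβ2⟩

/-- **A backward half-trajectory extends to a global trajectory.**  Let `W ∈ C¹(ℝ³; ℝ³)` have linear growth `‖W y‖ ≤ a‖y‖ + b`,
and let `Yp` satisfy `Yp' = −W(Yp)` at every `t ≥ 0` (two-sided derivative).  Then there is `Y : ℝ → ℝ³` with `Y t = Yp t` for
`t ≥ 0` and `Y' = −W(Y)` at EVERY real `t` (for `t < 0`, `Y t = β(−t)` with `β` the forward `W`-solution from `Yp 0`; the one-sided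
derivatives at `0` agree).  This is the input shape of the tree's trajectory-level lemmas
(`IsSelfSimilarEulerProfile.tendsto_transport_comp_of_bounded`, `NodalContinuum.exists_mapClusterPt_stretching_ge_one`, …).
[folklore; Hartman2002 Ch. II Thm. 3.1] -/
theorem exists_hasDerivAt_extension_of_linearGrowth {W : EuclideanSpace ℝ (Fin 3) → EuclideanSpace ℝ (Fin 3)}
    (hW : ContDiff ℝ 1 W) {a b : ℝ} (ha : 0 ≤ a) (hb : 0 ≤ b) (hab : ∀ y, ‖W y‖ ≤ a * ‖y‖ + b)
    {Yp : ℝ → EuclideanSpace ℝ (Fin 3)} (hp : ∀ t, 0 ≤ t → HasDerivAt Yp ((-1 : ℝ) • W (Yp t)) t) :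
    ∃ Y : ℝ → EuclideanSpace ℝ (Fin 3), (∀ t, 0 ≤ t → Y t = Yp t) ∧ ∀ t, HasDerivAt Y ((-1 : ℝ) • W (Y t)) t := by
  set x := Yp 0 with hx
  obtain ⟨β, hβ0, hβ1, hβ2⟩ := exists_forward_solution_of_linearGrowth hW ha hb hab x
  refine ⟨fun t => if 0 ≤ t then Yp t else β (-t), fun t ht => if_pos ht, fun t => ?_⟩
  rcases lt_trichotomy 0 t with ht | rfl | ht
  · -- `t > 0`
    have heq : (fun s => if 0 ≤ s then Yp s else β (-s)) =ᶠ[𝓝 t] Yp := by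
      filter_upwards [Ioi_mem_nhds ht] with s hs
      exact if_pos (le_of_lt hs)
    rw [show (fun s => if 0 ≤ s then Yp s else β (-s)) t = Yp t from if_pos ht.le]
    exact (hp t ht.le).congr_of_eventuallyEq heq
  · -- `t = 0`: glue the one-sided derivatives
    have hval : (fun s : ℝ => if 0 ≤ s then Yp s else β (-s)) 0 = x := by simp [hx]
    have hr : HasDerivWithinAt (fun s => if 0 ≤ s then Yp s else β (-s)) ((-1 : ℝ) • W x) (Ici 0) 0 := by
      have h1 : HasDerivWithinAt Yp ((-1 : ℝ) • W (Yp 0)) (Ici 0) 0 := (hp 0 le_rfl).hasDerivWithinAt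
      exact h1.congr (fun s hs => if_pos hs) (by simp)
    have hl : HasDerivWithinAt (fun s => if 0 ≤ s then Yp s else β (-s)) ((-1 : ℝ) • W x) (Iic 0) 0 := by
      have h1 : HasDerivWithinAt β (W (β 0)) (Ici 0) 0 := hβ1 0 le_rfl
      have h2 : HasDerivWithinAt (β ∘ Neg.neg) ((-1 : ℝ) • W (β 0)) (Iic 0) 0 := by
        refine HasDerivWithinAt.scomp (0 : ℝ) (by simpa using h1)
          ((hasDerivAt_neg (0 : ℝ)).hasDerivWithinAt) fun s hs => ?_
        simpa using hs
      rw [hβ0] at h2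
      refine h2.congr (fun s hs => ?_) (by simp [hx, hβ0])
      rcases eq_or_lt_of_le (show s ≤ 0 from hs) with h | h
      · simp [h, hx, hβ0]
      · simp [not_le.2 h]
    have := hl.union hr
    rw [Iic_union_Ici, hasDerivWithinAt_univ] at this
    simpa [hx] using this
  · -- `t < 0`
    have hnt : (0 : ℝ) < -t := by linarith
    have h1 : HasDerivAt β (W (β (-t))) (-t) := hβ2 (-t) hnt
    have h2 : HasDerivAt (β ∘ Neg.neg) ((-1 : ℝ) • W (β (-t))) t := HasDerivAt.scomp t h1 (hasDerivAt_neg t)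
    have heq : (fun s => if 0 ≤ s then Yp s else β (-s)) =ᶠ[𝓝 t] (β ∘ Neg.neg) := by
      filter_upwards [Iio_mem_nhds ht] with s (hs : s < 0)
      simp only [if_neg (not_le.2 hs), Function.comp_apply]
    rw [show (fun s => if 0 ≤ s then Yp s else β (-s)) t = β (-t) from if_neg (not_le.2 ht)]
    exact h2.congr_of_eventuallyEq heq

end Summit.NavierStokesRegularity.NavierStokesRegularity.Theorems.PowerGaugeEulerLiouville.Loc

end
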